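import Summits.NavierStokesRegularity.NavierStokesRegularity.Theorems.CoriolisHeadScaleNaturalDecayTools
import Summits.NavierStokesRegularity.NavierStokesRegularity.Theorems.CoriolisHeadNoCoRotatingCoreOfPineauVicol
import Literature.Analysis.FluidPDE.NSBoundedHigherRegularityQuantProofs
import Literature.Analysis.FluidPDE.WeakSolutionProofs
import HarnessLib

/-!
# CoriolisHeadScaleNaturalDecay — crux `NoCoRotatingCore` (stmt-NavierStokesRegularity-22676), REGISTERED line
# `far_field_constancy` v2 (skeleton 15c9a82ad206abb9, planner ns-idea-10): **stub K1a `stub_scaleNaturalDecay` proved,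
# statement verbatim** (seat ns-ffc-k1 g3)

K1a (the line's hard core, labelled XL): every bounded smooth rotated self-similar profile (ANY `ν, a > 0`, ANY skew `B`)
has SCALE-NATURAL DERIVATIVE DECAY, `‖y‖‖DU(y)‖ + ‖y‖²‖D²U(y)‖ → 0`.

PROOF (the route the line card did NOT foresee — through the rescue line `local_energy_rescue`, all of whose analytic
stubs are tree theorems, and PHYSICAL-space local regularity, where the drift `ay − By` is invisible):
1. normalise `ν = 1` (`rotatedProfileSystem_normalise`), recentre `W ↦ V = W(· + y₀) − b` (S1 `stub_driftNormalForm`) to a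
   `BMO₂` pressure; density `β > 1` (S2 `stub_densityBootstrap`); TYPE-I DECAY `‖V(y)‖ ≤ K'/(1+‖y‖)`
   (S3 `typeIDecay_of_localEnergy` = S3a + S3b);
2. the physical field `u(t,x) = λe^{θB}V(λe^{−θB}x)` is then BOUNDED by `K'/‖x‖ ≤ 4K'` on every cylinder
   `Q((0,x₀), 1/8) ⊆ Q₁(0,0)`, `‖x₀‖ = 3/8`, with `p ∈ L^{3/2}(Q₁(0,0))` by S3a's CKN class; the tree's QUANTITATIVE
   higher interior regularity of bounded solutions (`NSBoundedHigherRegularityBounds_holds`, Seregin–Šverák 2009 §2: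
   constants depending only on `R, M, ‖p‖_{3/2}`) bounds `‖D_xⁿu‖ ≤ K₀` on `Q((0,x₀), 1/16)`, `n ≤ 2`, UNIFORMLY in `x₀`;
3. reading the profile off its field, `V(y) = λ⁻¹e^{−θB}u(t, λ⁻¹e^{θB}y)` with `λ = 8‖y‖/3`, gives `‖DV(y)‖ ≤ K₀(3/8)²‖y‖⁻²`,
   `‖D²V(y)‖ ≤ K₀(3/8)³‖y‖⁻³` (`norm_iteratedFDeriv_profile_le`); translation and dilation carry this back to `U`.

HONEST FRAMING.  This closes the registered stub K1a by name; together with K1b (p613432), K1c (p627657) the line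
`far_field_constancy` is complete MODULO its declared residual R1 = Pineau–Vicol Conjecture 1.1 AS PRINTED (open problem;
cf. `noCoRotatingCore_of_pineauVicolConjecture`).  `NoCoRotatingCore`, Conjecture 1.1 and NS regularity are NOT proved.

References: G. Seregin, V. Šverák, Comm. PDE 34 (2009) §2 [SereginSverak2009]; H. Koch, N. Nadirashvili, G. Seregin, V. Šverák,
Acta Math. 203 (2009) [KochNadirashviliSereginSverak2009]; T.-P. Tsai, ARMA 143 (1998) §4 [Tsai1998]; line card
`Cruxes/NoCoRotatingCore/Lines/far_field_constancy.md` (K1a).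
-/

noncomputable section

open MeasureTheory Set Function Filter Topology Metric InnerProductSpace Real
open scoped RealInnerProductSpace Laplacian ContDiff Topology ENNReal NNReal

-- the summit and its single sub-problem share the name (CONVENTIONS §1), as in every Theorems file
set_option linter.dupNamespace false
-- nested operator types `ℝ³ →L[ℝ] ℝ³` inside the Banach algebra `ℝ³ →L[ℝ] ℝ³` (as in `CoriolisHeadTypeIRateTransport`)
set_option maxSynthPendingDepth 3

namespace Summit.NavierStokesRegularity.NavierStokesRegularity.Theorems.CoriolisHead

namespace ScaleNaturalDecay

open Literature.Analysis.FluidPDE LocalEnergyRescue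

section UnitViscosity

variable {a : ℝ} {B : EuclideanSpace ℝ (Fin 3) →L[ℝ] EuclideanSpace ℝ (Fin 3)}
  {V W : EuclideanSpace ℝ (Fin 3) → EuclideanSpace ℝ (Fin 3)} {P Q : EuclideanSpace ℝ (Fin 3) → ℝ}

/-! ## §1 Derivative decay of a DECAYING profile (`ν = 1`) from interior regularity in physical space -/

/-- **Derivative decay of a decaying profile.**  A smooth rotated profile with `ν = 1` (any `a > 0`, any skew `B`), bounded,
with `BMO₂` pressure, sub-volume density `β > 1` and Type-I decay `‖V(y)‖ ≤ K'/(1 + ‖y‖)` has `‖DV(y)‖ ≤ C/‖y‖²` and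
`‖D²V(y)‖ ≤ C/‖y‖³` beyond a radius: S3a puts its physical field in the CKN class on `Q₁(0,0)`, the decay bounds the field
by `4K'` on the cylinders `Q((0,x₀),1/8)`, `‖x₀‖ = 3/8`, the quantitative interior regularity of bounded solutions
(`NSBoundedHigherRegularityBounds_holds`) bounds `D_xⁿu`, `n ≤ 2`, on `Q((0,x₀),1/16)` uniformly in `x₀`, and the profile is
read off the field at `λ = 8‖y‖/3`. [cite: SereginSverak2009, §2 p. 8] -/
theorem derivDecay_of_decay (ha : 0 < a) (hB : ∀ x, inner ℝ (B x) x = 0) (hV : ContDiff ℝ (⊤ : ℕ∞) V)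
    (hP : ContDiff ℝ 2 P) (hdiv : VectorCalculus.IsDivFree V)
    (heq : ∀ y, -((1 : ℝ) • Laplacian.laplacian V y) + a • V y + a • fderiv ℝ V y y + (B (V y) - fderiv ℝ V y (B y)) +
      Literature.Analysis.FluidPDE.convect V V y + gradient P y = 0)
    {M : ℝ} (hM : ∀ y, ‖V y‖ ≤ M) {K : ℝ}
    (hbmo : ∀ (z : EuclideanSpace ℝ (Fin 3)) (ρ : ℝ), 0 < ρ → ∃ m : ℝ, ∫ y in ball z ρ, (P y - m) ^ 2 ≤ K * ρ ^ 3)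
    {β K₂ : ℝ} (hβ : 1 < β)
    (hdens : ∀ (z : EuclideanSpace ℝ (Fin 3)) (ρ : ℝ), 1 ≤ ρ → ∫ y in ball z ρ, ‖V y‖ ^ 2 ≤ K₂ * ρ ^ (3 - β))
    {K' : ℝ} (hdec : ∀ y, ‖V y‖ ≤ K' / (1 + ‖y‖)) :
    ∃ C R₀ : ℝ, 0 ≤ C ∧ 0 < R₀ ∧
      (∀ y, R₀ ≤ ‖y‖ → ‖fderiv ℝ V y‖ ≤ C / ‖y‖ ^ 2) ∧
      (∀ y, R₀ ≤ ‖y‖ → ‖iteratedFDeriv ℝ 2 V y‖ ≤ C / ‖y‖ ^ 3) := by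
  have hK'0 : 0 ≤ K' := by
    have h := hdec 0
    rw [norm_zero, add_zero, div_one] at h
    exact (norm_nonneg _).trans h
  -- the physical field
  set u : ℝ → EuclideanSpace ℝ (Fin 3) → EuclideanSpace ℝ (Fin 3) := fun t x =>
    (Real.sqrt (2 * a * (0 - t)))⁻¹ • (NormedSpace.exp ((a⁻¹ * Real.log (Real.sqrt (2 * a * (0 - t)))⁻¹) • B))
      (V ((Real.sqrt (2 * a * (0 - t)))⁻¹ •
        (NormedSpace.exp ((-(a⁻¹ * Real.log (Real.sqrt (2 * a * (0 - t)))⁻¹)) • B)) x)) with hu_def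
  have hu : ∀ (t : ℝ) (x : EuclideanSpace ℝ (Fin 3)), u t x =
      (Real.sqrt (2 * a * (0 - t)))⁻¹ • (NormedSpace.exp ((a⁻¹ * Real.log (Real.sqrt (2 * a * (0 - t)))⁻¹) • B))
        (V ((Real.sqrt (2 * a * (0 - t)))⁻¹ •
          (NormedSpace.exp ((-(a⁻¹ * Real.log (Real.sqrt (2 * a * (0 - t)))⁻¹)) • B)) x)) := fun t x => rfl
  -- its CKN class (S3a) and its classical structure
  obtain ⟨-, p, hsw, -, -, hpfin⟩ := stub_localEnergyClass 1 a one_pos ha B V P hV hP hB hdiv heq ⟨M, hM⟩ K hbmo β K₂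
    hβ hdens u hu
  have hNS := isClassicalNSSolutionOn_physicalField one_pos ha hV (hP.of_le (by norm_num)) hB hdiv heq hu
  -- the uniform regularity constant
  set P₀ : ℝ≥0 := (∫⁻ w in parabolicCylinder 1 ((0 : ℝ), (0 : EuclideanSpace ℝ (Fin 3))), ‖p w.1 w.2‖ₑ ^ (3 / 2 : ℝ)).toNNReal
    with hP₀
  obtain ⟨K₀, hK₀⟩ := NSBoundedHigherRegularityBounds_holds.exists_uniform_bound (1 / 8) (4 * K') P₀ (r := 1 / 16)
    ⟨by norm_num, by norm_num⟩ 2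
  set R₀ : ℝ := 3 / 8 * Real.sqrt (128 / a) + 1 with hR₀
  have hR₀pos : 0 < R₀ := by positivity
  -- the core estimate
  have core : ∀ y : EuclideanSpace ℝ (Fin 3), R₀ ≤ ‖y‖ → ∀ n ≤ 2,
      ‖iteratedFDeriv ℝ n V y‖ ≤ max K₀ 0 * ((3 / 8) / ‖y‖) ^ (n + 1) := by
    intro y hy n hn
    have hy0 : 0 < ‖y‖ := hR₀pos.trans_le hy
    have hy0' : ‖y‖ ≠ 0 := hy0.ne'
    -- the scale `λ = ‖y‖/(3/8)` and the time `t = −(2aλ²)⁻¹ ∈ (−1/256, 0)`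
    set lam : ℝ := ‖y‖ / (3 / 8) with hlam
    have hlam0 : 0 < lam := by positivity
    set t : ℝ := -(2 * a * lam ^ 2)⁻¹ with ht
    have ht0 : t < 0 := by rw [ht]; exact neg_neg_of_pos (by positivity)
    have hlamt : (Real.sqrt (2 * a * (0 - t)))⁻¹ = lam := by
      have e : 2 * a * (0 - t) = (lam⁻¹) ^ 2 := by
        rw [ht, zero_sub, neg_neg, inv_pow]
        field_simp
      rw [e, Real.sqrt_sq (by positivity), inv_inv]
    have ht1 : -((1 : ℝ) / 16) ^ 2 < t := by
      have h1 : Real.sqrt (128 / a) < lam := by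
        rw [hlam, lt_div_iff₀ (by norm_num : (0 : ℝ) < 3 / 8)]
        nlinarith [Real.sqrt_nonneg (128 / a)]
      have h2 : 128 / a < lam ^ 2 := by
        have := Real.sq_sqrt (by positivity : (0 : ℝ) ≤ 128 / a)
        nlinarith [Real.sqrt_nonneg (128 / a)]
      have h3 : 256 < 2 * a * lam ^ 2 := by
        have := (div_lt_iff₀ ha).1 h2
        nlinarith
      rw [ht, neg_lt_neg_iff]
      calc (2 * a * lam ^ 2)⁻¹ < 256⁻¹ := inv_strictAnti₀ (by norm_num) h3
        _ = ((1 : ℝ) / 16) ^ 2 := by norm_num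
    set θ : ℝ := a⁻¹ * Real.log lam with hθ
    set x₀ : EuclideanSpace ℝ (Fin 3) := (lam⁻¹ • NormedSpace.exp (θ • B)) y with hx₀
    have hx₀n : ‖x₀‖ = 3 / 8 := by
      have e : x₀ = lam⁻¹ • NormedSpace.exp (θ • B) y := rfl
      rw [e, norm_smul, Real.norm_of_nonneg (inv_nonneg.2 hlam0.le), TypeIRate.norm_exp_smul_skew hB, hlam]
      field_simp
    set z : ℝ × EuclideanSpace ℝ (Fin 3) := ((0 : ℝ), x₀) with hz
    have hz1 : z.1 = 0 := rfl
    have hz2 : z.2 = x₀ := rfl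
    -- the sub-cylinder `Q(z, 1/8) ⊆ Q₁(0,0)` below the blow-up time
    have hsubQ : parabolicCylinder (1 / 8) z ⊆ parabolicCylinder 1 ((0 : ℝ), (0 : EuclideanSpace ℝ (Fin 3))) := by
      intro w hw
      rw [mem_parabolicCylinder] at hw ⊢
      obtain ⟨⟨h1, h2⟩, h3⟩ := hw
      rw [hz1] at h1 h2
      rw [hz2] at h3
      have h4 : dist w.2 (0 : EuclideanSpace ℝ (Fin 3)) ≤ dist w.2 x₀ + dist x₀ 0 := dist_triangle _ _ _
      rw [dist_zero_right x₀, hx₀n] at h4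
      refine ⟨⟨?_, h2⟩, ?_⟩
      · show (0 : ℝ) - 1 ^ 2 < w.1
        linarith
      · show dist w.2 (0 : EuclideanSpace ℝ (Fin 3)) < 1
        linarith
    have hle : parabolicCylinderOpens (1 / 8) z ≤ parabolicCylinderOpens 1 ((0 : ℝ), (0 : EuclideanSpace ℝ (Fin 3))) :=
      fun w hw => hsubQ hw
    have hdist : IsDistributionalNSSolutionOn (parabolicCylinderOpens (1 / 8) z) 1 0 u p :=
      IsDistributionalNSSolutionOn.mono_holds hsw.distributional hle
    -- boundedness by `4K'` on the sub-cylinder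
    have hbd : ∀ᵐ w ∂(volume.restrict (parabolicCylinder (1 / 8) z)), ‖u w.1 w.2‖ ≤ 4 * K' := by
      refine (ae_restrict_iff' (isOpen_parabolicCylinder _ _).measurableSet).2 (ae_of_all _ fun w hw => ?_)
      rw [mem_parabolicCylinder] at hw
      obtain ⟨⟨-, h2⟩, h3⟩ := hw
      rw [hz1] at h2
      rw [hz2] at h3
      have hw1 : w.1 < 0 := h2
      set lam' : ℝ := (Real.sqrt (2 * a * (0 - w.1)))⁻¹ with hlam'
      have hlam'0 : 0 < lam' := scale_pos ha hw1
      have hxw : 1 / 4 ≤ ‖w.2‖ := by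
        have h4 : dist x₀ (0 : EuclideanSpace ℝ (Fin 3)) ≤ dist x₀ w.2 + dist w.2 0 := dist_triangle _ _ _
        rw [dist_zero_right, hx₀n, dist_comm, dist_zero_right] at h4
        linarith
      rw [hu]
      show ‖lam' • NormedSpace.exp ((a⁻¹ * Real.log lam') • B)
          (V (lam' • NormedSpace.exp ((-(a⁻¹ * Real.log lam')) • B) w.2))‖ ≤ 4 * K'
      rw [norm_smul, Real.norm_of_nonneg hlam'0.le, TypeIRate.norm_exp_smul_skew hB]
      have hd := hdec (lam' • NormedSpace.exp ((-(a⁻¹ * Real.log lam')) • B) w.2)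
      rw [norm_smul, Real.norm_of_nonneg hlam'0.le, TypeIRate.norm_exp_smul_skew hB] at hd
      have hpos : 0 < 1 + lam' * ‖w.2‖ := by positivity
      calc lam' * ‖V (lam' • NormedSpace.exp ((-(a⁻¹ * Real.log lam')) • B) w.2)‖
          ≤ lam' * (K' / (1 + lam' * ‖w.2‖)) := mul_le_mul_of_nonneg_left hd hlam'0.le
        _ ≤ 4 * K' := by
            rw [mul_div_assoc', div_le_iff₀ hpos]
            nlinarith [mul_nonneg hlam'0.le hK'0]
    -- the pressure bound on the sub-cylinder
    have hpP : ∫⁻ w in parabolicCylinder (1 / 8) z, ‖p w.1 w.2‖ₑ ^ (3 / 2 : ℝ) ≤ P₀ := by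
      refine (lintegral_mono_set hsubQ).trans (le_of_eq ?_)
      rw [hP₀, ENNReal.coe_toNNReal hpfin.ne]
    obtain ⟨V', hae, hV'c, -, -, hV'K⟩ := hK₀ u p z hdist hbd hpP
    -- `u = V'` on the open sub-cylinder (both continuous)
    have hQsub' : parabolicCylinder (1 / 8) z ⊆ Iio (0 : ℝ) ×ˢ (univ : Set (EuclideanSpace ℝ (Fin 3))) :=
      fun w hw => ⟨by have h := (mem_parabolicCylinder.1 hw).1.2; rwa [hz1] at h, mem_univ _⟩
    have hEq : EqOn (uncurry u) (uncurry V') (parabolicCylinder (1 / 8) z) :=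
      Measure.eqOn_open_of_ae_eq hae (isOpen_parabolicCylinder _ _) (hNS.smooth_velocity.continuousOn.mono hQsub') hV'c
    -- the point `(t, x₀)` lies in `Q(z, 1/16)`
    have hw16 : ((t, x₀) : ℝ × EuclideanSpace ℝ (Fin 3)) ∈ parabolicCylinder (1 / 16) z := by
      rw [mem_parabolicCylinder, hz1, hz2]
      refine ⟨⟨?_, ht0⟩, ?_⟩
      · show (0 : ℝ) - (1 / 16) ^ 2 < t
        linarith
      · show dist x₀ x₀ < 1 / 16
        rw [dist_self]; norm_num
    have hw8 : ((t, x₀) : ℝ × EuclideanSpace ℝ (Fin 3)) ∈ parabolicCylinder (1 / 8) z := by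
      rw [mem_parabolicCylinder, hz1, hz2] at hw16 ⊢
      obtain ⟨⟨h1, h2⟩, h3⟩ := hw16
      exact ⟨⟨by linarith, h2⟩, h3.trans (by norm_num)⟩
    -- derivative bound at `(t, x₀)`
    have hder : ‖iteratedFDeriv ℝ n (u t) x₀‖ ≤ K₀ := by
      have e : iteratedFDeriv ℝ n (u t) x₀ = iteratedFDeriv ℝ n (V' t) x₀ :=
        iteratedFDeriv_slice_eq_of_eqOn (isOpen_parabolicCylinder (1 / 8) z) hEq n hw8
      rw [e]
      exact hV'K n hn (t, x₀) hw16
    -- transfer to the profile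
    have ht' : t ∈ Iio (0 : ℝ) := ht0
    have hut : ContDiff ℝ (2 : ℕ) (u t) := (hNS.contDiff_velocity ht').of_le (by norm_cast)
    have h := norm_iteratedFDeriv_profile_le ha hB hu ht0 hut hn y
    rw [hlamt] at h
    refine h.trans ?_
    have hK₀' : K₀ ≤ max K₀ 0 := le_max_left _ _
    have e3 : lam⁻¹ = (3 / 8) / ‖y‖ := by rw [hlam, inv_div]
    rw [← e3, pow_succ, mul_comm (lam⁻¹ ^ n) lam⁻¹, mul_comm (max K₀ 0)]
    exact mul_le_mul_of_nonneg_left (hder.trans hK₀') (by positivity)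
  -- the two conclusions
  refine ⟨max K₀ 0, R₀, le_max_right _ _, hR₀pos, fun y hy => ?_, fun y hy => ?_⟩
  · have hy0 : 0 < ‖y‖ := hR₀pos.trans_le hy
    rw [← norm_iteratedFDeriv_one]
    calc ‖iteratedFDeriv ℝ 1 V y‖ ≤ max K₀ 0 * ((3 / 8) / ‖y‖) ^ (1 + 1) := core y hy 1 (by norm_num)
      _ = max K₀ 0 * (3 / 8) ^ 2 / ‖y‖ ^ 2 := by ring
      _ ≤ max K₀ 0 / ‖y‖ ^ 2 := by
          apply div_le_div_of_nonneg_right _ (by positivity)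
          nlinarith [le_max_right K₀ 0]
  · have hy0 : 0 < ‖y‖ := hR₀pos.trans_le hy
    calc ‖iteratedFDeriv ℝ 2 V y‖ ≤ max K₀ 0 * ((3 / 8) / ‖y‖) ^ (2 + 1) := core y hy 2 le_rfl
      _ = max K₀ 0 * (3 / 8) ^ 3 / ‖y‖ ^ 3 := by ring
      _ ≤ max K₀ 0 / ‖y‖ ^ 3 := by
          apply div_le_div_of_nonneg_right _ (by positivity)
          nlinarith [le_max_right K₀ 0]

/-! ## §2 Derivative decay of a BOUNDED profile (`ν = 1`) after recentring, carried back -/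

/-- **Derivative decay of a bounded profile (`ν = 1`).**  Recentring by S1, density by S2, decay by S3, `derivDecay_of_decay`
for the recentred profile, and the translation `W(y) = V(y − y₀) + b` back. [cite: SereginSverak2009, §2 p. 8] -/
theorem derivDecay_of_bounded (ha : 0 < a) (hB : ∀ x, inner ℝ (B x) x = 0) (hW : ContDiff ℝ (⊤ : ℕ∞) W)
    (hQ : ContDiff ℝ 2 Q) (hdiv : VectorCalculus.IsDivFree W)
    (heq : ∀ y, -((1 : ℝ) • Laplacian.laplacian W y) + a • W y + a • fderiv ℝ W y y + (B (W y) - fderiv ℝ W y (B y)) +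
      Literature.Analysis.FluidPDE.convect W W y + gradient Q y = 0)
    {M : ℝ} (hM : ∀ y, ‖W y‖ ≤ M) :
    ∃ C R₀ : ℝ, 0 ≤ C ∧ 0 < R₀ ∧
      (∀ y, R₀ ≤ ‖y‖ → ‖fderiv ℝ W y‖ ≤ C / ‖y‖ ^ 2) ∧
      (∀ y, R₀ ≤ ‖y‖ → ‖iteratedFDeriv ℝ 2 W y‖ ≤ C / ‖y‖ ^ 3) := by
  obtain ⟨y₀, b, P', K, hV, hP', hdivV, heqV, ⟨M', hM'⟩, hBMO⟩ :=
    stub_driftNormalForm 1 a one_pos ha B W Q hW hQ hB hdiv heq ⟨M, hM⟩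
  obtain ⟨β, K₂, hβ, hdens⟩ :=
    stub_densityBootstrap 1 a one_pos ha B (fun y => W (y + y₀) - b) P' hV hP' hB hdivV heqV ⟨M', hM'⟩ K hBMO
  obtain ⟨K', hdec⟩ := typeIDecay_of_localEnergy 1 a one_pos ha B (fun y => W (y + y₀) - b) P' hV hP' hB hdivV heqV
    ⟨M', hM'⟩ K hBMO β K₂ hβ hdens
  obtain ⟨C, R₀, hC, hR₀, h1, h2⟩ := derivDecay_of_decay ha hB hV hP' hdivV heqV hM' hBMO hβ hdens hdec
  have hWV : ∀ y, W y = (fun y => W (y + y₀) - b) (y - y₀) + b := fun y => by simp only [sub_add_cancel]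
  obtain ⟨h1', h2'⟩ := derivDecay_translate (hV.of_le (by norm_cast)) hC hR₀.le h1 h2 y₀ b hWV
  refine ⟨8 * C, 2 * (R₀ + ‖y₀‖) + 1, by positivity, by positivity, fun y hy => (h1' y hy).trans ?_, h2'⟩
  have hy0 : 0 < ‖y‖ := by linarith [norm_nonneg y₀, hR₀]
  exact div_le_div_of_nonneg_right (by nlinarith) (by positivity)

end UnitViscosity

end ScaleNaturalDecay

/-! ## §3 Stub K1a by name -/

-- the skeleton of record states the stub with this local notation; the header below is its text verbatim
local notation "E3" => EuclideanSpace ℝ (Fin 3)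

open ScaleNaturalDecay LocalEnergyRescue Literature.Analysis.FluidPDE in
/-- **stub K1a — `stub_scaleNaturalDecay`** of the REGISTERED line `far_field_constancy` v2 (crux `CoriolisHead.NoCoRotatingCore`,
item 22676; skeleton `Cruxes/NoCoRotatingCore/Lines/far_field_constancy.lean`, sha 15c9a82ad206abb9; statement verbatim,
with the skeleton's local notation `E3`): every bounded smooth rotated self-similar profile
(ANY `ν, a > 0`, ANY skew `B`) has SCALE-NATURAL DERIVATIVE DECAY `‖y‖‖DU(y)‖ + ‖y‖²‖D²U(y)‖ → 0`.  Proof: normalise `ν = 1`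
(`rotatedProfileSystem_normalise`), `derivDecay_of_bounded` (recentring S1 + density S2 + Type-I decay S3 of the rescue line,
then interior regularity of the BOUNDED physical field on cylinders below the blow-up time via
`NSBoundedHigherRegularityBounds_holds`, read back along the similarity map), dilation back (`derivDecay_dilate`) and the
`ε`–`R` form.  `NoCoRotatingCore`, the residual R1 (Pineau–Vicol Conj. 1.1 as printed) and NS regularity are NOT proved.
[cite: SereginSverak2009, §2 p. 8; Tsai1998 Lemma 4.1 and Cor. 4.3 (pp. 46–47)] -/
theorem stub_scaleNaturalDecay :
    ∀ (ν a : ℝ), 0 < ν → 0 < a → ∀ (B : E3 →L[ℝ] E3) (U : E3 → E3) (P : E3 → ℝ),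
      ContDiff ℝ (⊤ : ℕ∞) U → ContDiff ℝ 2 P → (∀ x, inner ℝ (B x) x = 0) →
      Literature.Analysis.FluidPDE.VectorCalculus.IsDivFree U →
      (∀ y, -(ν • Laplacian.laplacian U y) + a • U y + a • fderiv ℝ U y y
        + (B (U y) - fderiv ℝ U y (B y)) + Literature.Analysis.FluidPDE.convect U U y
        + gradient P y = 0) →
      (∃ M : ℝ, ∀ y, ‖U y‖ ≤ M) →
      (∀ ε : ℝ, 0 < ε → ∃ R : ℝ, ∀ y, R ≤ ‖y‖ →
        ‖y‖ * ‖fderiv ℝ U y‖ + ‖y‖ ^ 2 * ‖iteratedFDeriv ℝ 2 U y‖ ≤ ε) := by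
  intro ν a hν ha B U P hU hP hB hdiv heq hbdd
  obtain ⟨M, hM⟩ := hbdd
  -- normal form `ν = 1`, `a = ½`, frame `(2a)⁻¹B`
  obtain ⟨c, hc0, -, hW, hR, hB', hdivW, heqW, -⟩ :=
    rotatedProfileSystem_normalise hν ha hU (hP.of_le (by norm_num)) hB hdiv heq
  have hkpos : 0 < c / ν := div_pos hc0 hν
  have hMW : ∀ y : EuclideanSpace ℝ (Fin 3), ‖(fun w : EuclideanSpace ℝ (Fin 3) => (c / ν) • U (c • w)) y‖ ≤ c / ν * M :=
    fun y => by
    show ‖(c / ν) • U (c • y)‖ ≤ c / ν * M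
    rw [norm_smul, Real.norm_of_nonneg hkpos.le]
    exact mul_le_mul_of_nonneg_left (hM _) hkpos.le
  obtain ⟨C, R₀, -, hR₀, h1, h2⟩ := derivDecay_of_bounded (a := 1 / 2) (B := (2 * a)⁻¹ • B) (by norm_num) hB' hW
    (hR.of_le (by norm_cast)) hdivW heqW hMW
  -- dilate back: `U(y) = (ν/c) W(c⁻¹ y)`
  have hUW : ∀ y : EuclideanSpace ℝ (Fin 3),
      U y = (ν / c) • (fun w : EuclideanSpace ℝ (Fin 3) => (c / ν) • U (c • w)) (c⁻¹ • y) := fun y => by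
    show U y = (ν / c) • ((c / ν) • U (c • (c⁻¹ • y)))
    rw [smul_smul, smul_smul, mul_inv_cancel₀ hc0.ne', one_smul, div_mul_div_comm, mul_comm ν c,
      div_self (by positivity), one_smul]
  obtain ⟨h1', h2'⟩ := derivDecay_dilate (hW.of_le (by norm_cast)) hR₀ h1 h2 (inv_pos.2 hc0) hUW
  exact scaleNaturalDecay_of_derivDecay (div_pos hR₀ (inv_pos.2 hc0)) h1' h2'

end Summit.NavierStokesRegularity.NavierStokesRegularity.Theorems.CoriolisHead

end
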